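import Literature.MathematicalPhysics.QuantumFieldTheory.Balaban1983to89.HaarExponentialChartProduct
import Literature.MathematicalPhysics.QuantumFieldTheory.Balaban1983to89.HaarDensitySpecialUnitaryGlobal

/-!
# `Balaban1983to89.HaarExponentialChartProductExplicit` — [Balaban1985UV3] (18) p. 260 for the product Haar measure
# over a finite bond set, continued: `SU(N)` on gen 14's alcove, and the EXPLICIT factorwise densities
# `Π_b Π_{j,k} sinc((θ_j(A_b) − θ_k(A_b))/2)` (`U(N)`), `Π_b Π_{j<k} sinc((θ_j+θ_k)/2)` (`SO(N)`),
# `Π_b Π_{{j,k}} sinc((θ_j+θ_k)/2)` (`Sp(n)`)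

statement-level skeleton of published theorems with citation tags; proofs where landed; nothing here is a claim
about the Yang–Mills mass gap

Mega-formalization `lit-balaban` (HOME `run/shared/lean/pub/lit-balaban/`), unit `lit-balaban-p28` gen 16 (Phase-2
proof seat; free-target protocol G.5-34(d), TAKING 2026-08-23T11:03Z).  File 9 (rider to file 8
`HaarExponentialChartProduct`, which proves `∫_{G^B} F d(⊗μ) = σ₀^{|B|} ∫_{Ω^B} F((Θ A_b)_b) Π_b |det jac(A_b)| d(⊗η)`
for a general chart and instantiates it for `U(N)`, `SO(N)`, `Sp(n)` on the ball `{‖A‖ < π}`).  THIS FILE adds the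
`SU(N)` instance on gen 14's full-measure injectivity domain (the alcove `Ω` of `HaarDensitySpecialUnitaryGlobal`) and
rewrites the factorwise density `|det jac(A_b)|` by the one-variable explicit formulas of gens 11–12
(`jacDensity_unitaryLogChart_eq_of_roots`, `jacDensity_specialOrthogonal_eq_of_diag`, `jacDensity_symplectic_J_eq_of_diag`)
— print's *«σ(A′) is a density which can be calculated explicitly for all classical groups»* inside (18).  SKELETON rows
served (SUPPORT cells only, no head change): B10.Eq21 / display E18 ([Balaban1985UV3] (18)/(21) pp. 260–261, owner
r07), B13.Eq1.37 (r10), B12.Eq2.10–2.12 (r09/r20).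

CITATION HEADER.  [Balaban1985UV3] T. Bałaban, CMP **102** (1985) 255–275, p. 260 (PDF p. 6): *«dU′ = σ(A′)dA′ = σ₀
σ/σ₀ (A′)dA′, σ₀ = σ(0) … σ(A′) is a density which can be calculated explicitly for all classical groups … [(18)] …
exp[… + log σ₀ |Ω₁|]»*.  [Helgason2000] Ch. I §1 Thm. 1.14 (13) p. 96.

WHAT IS PROVED (theorems only; 0 definitions, 0 named facts, 0 sorry; axioms standard).
* §1 **`lintegral_pi_haar_specialUnitaryGroup_eq`** (`SU(N)`-valued bond variables, alcove domain).
* §2 **`lintegral_pi_haar_unitaryGroup_eq_prod_sinc_of_roots`** ∕ **`lintegral_pi_haar_unitaryGroup_eq_prod_sinc`** ∕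
  `lintegral_pi_haarProbability_unitaryGroup_eq_prod_sinc` (`U(N)`: `∫_{U(N)^B} F d(⊗μ) = σ₀^{|B|} ∫_{‖A_b‖<π ∀b}
  F((e^{A_b})_b) Π_b Π_jΠ_k sinc((θ_j(A_b) − θ_k(A_b))/2) d(⊗η)`, `σ₀ = 1/∫Π sinc dη` for the probability measure);
  **`lintegral_pi_haar_specialOrthogonal_eq_prod_sinc`** (`SO(N)`), **`lintegral_pi_haar_symplectic_eq_prod_sinc`** (`Sp(n)`).

HONEST SCOPE.  (i) `σ₀` identified, not evaluated.  (ii) `SU(N)` explicit density (gen 14's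
`jacDensity_specialUnitaryLogChart_eq_of_roots`) not restated for products (routine, same pattern).  (iii) Nothing of
gens 10–14 or files 1–8 is re-proved.  Failed printed steps: none (HOME/GAPS.md unchanged).
-/

noncomputable section

open NormedSpace Set Function Filter Topology MeasureTheory
open scoped ENNReal NNReal Matrix.Norms.L2Operator

namespace Literature.MathematicalPhysics.QuantumFieldTheory.Balaban1983to89

namespace HaarExponentialChartProduct

open HaarExponentialChart HaarExponentialChart.IsChartRep
open LogChartClosedSubgroup (unitarySubgroupLogChart)
open HaarDensityOrthogonalChart (specialOrthogonalSubgroup isClosed_specialOrthogonalSubgroup)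
open HaarDensitySymplecticChart (symplecticSubgroup isClosed_symplecticSubgroup)
open HaarSmallBallClosedSubgroup (compactSpace_of_isClosed_subgroup)

variable {n : Type*} [Fintype n] [DecidableEq n] (B : Type*) [Fintype B]

/-! ## §1 `SU(N)` on the alcove -/

section SpecialUnitary

open SpecialUnitaryAlcove (alcove measurableSet_alcove injOn_expChart_alcove)

variable [Nonempty n]
variable [MeasurableSpace (specialUnitaryLogChart n).lie] [BorelSpace (specialUnitaryLogChart n).lie]
  (η : Measure (specialUnitaryLogChart n).lie) [η.IsAddHaarMeasure]
  (μ : Measure (Matrix.specialUnitaryGroup n ℂ)) [μ.IsHaarMeasure]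

/-- **[Balaban1985UV3] (18) FOR `SU(N)`-VALUED BOND VARIABLES: `∫_{SU(N)^B} F d(⊗μ) = σ₀^{|B|} ∫_{Ω^B} F((e^{A_b})_b)
Π_b |det jac(A_b)| d(⊗η)`**, `Ω` = gen 14's alcove (full-measure injectivity domain of `SU(N)`),
`σ₀ = μ(SU(N))/∫_Ω |det jac| dη`. [cite: Balaban1985UV3, (18) p. 260] [cite: Helgason2000, Ch. I §1 Thm. 1.14 (13) p. 96] -/
theorem lintegral_pi_haar_specialUnitaryGroup_eq {F : (B → Matrix.specialUnitaryGroup n ℂ) → ℝ≥0∞}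
    (hF : Measurable F) :
    ∫⁻ U, F U ∂(Measure.pi fun _ : B => μ) =
      (μ Set.univ / ∫⁻ X in alcove n, jacDensity (lie_adStable_specialUnitaryGroup (n := n)) X ∂η) ^
          Fintype.card B *
        ∫⁻ A in Set.pi Set.univ (fun _ => alcove n),
          F (fun b => (isChartRep_specialUnitaryGroup (n := n)).expChart (A b)) *
            ∏ b, jacDensity (lie_adStable_specialUnitaryGroup (n := n)) (A b) ∂(Measure.pi fun _ : B => η) :=
  (isChartRep_specialUnitaryGroup (n := n)).lintegral_pi_haar_eq_of_null (lie_adStable_specialUnitaryGroup (n := n))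
    η μ B IsChartRep.chartRadius_pos le_rfl measurableSet_alcove injOn_expChart_alcove
    (HaarDensitySpecialUnitaryGlobal.haar_compl_image_alcove_eq_zero μ) hF

end SpecialUnitary

/-! ## §2 The explicit densities, factorwise: `U(N)`, `SO(N)`, `Sp(n)` -/

section UnitaryExplicit

open HaarDensityUnitaryChart (conjTranspose_eq_neg_of_mem_unitaryLogChart jacDensity_unitaryLogChart_eq_of_roots)
open HaarDensityUnitaryExplicit (isHermitian_neg_I_smul roots_charpoly_eq_of_skewHermitian)
open Complex

variable [MeasurableSpace (unitaryLogChart n).lie] [BorelSpace (unitaryLogChart n).lie]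
  (η : Measure (unitaryLogChart n).lie) [η.IsAddHaarMeasure]
  (μ : Measure (Matrix.unitaryGroup n ℂ)) [μ.IsHaarMeasure]

/-- **[Balaban1985UV3] (18) FOR `U(N)` WITH THE EXPLICIT DENSITY, any labelling `iθ_j(A)` of the characteristic
roots: `∫_{U(N)^B} F d(⊗μ) = σ₀^{|B|} ∫_{‖A_b‖<π ∀b} F((e^{A_b})_b) Π_b Π_j Π_k sinc((θ_j(A_b) − θ_k(A_b))/2) d(⊗η)`,
`σ₀ = μ(U(N))/∫_{‖A‖<π} Π_jΠ_k sinc dη`.** [cite: Balaban1985UV3, (18) p. 260] [cite: Helgason2000, Ch. I §1 Thm. 1.14 (13) p. 96] -/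
theorem lintegral_pi_haar_unitaryGroup_eq_prod_sinc_of_roots {F : (B → Matrix.unitaryGroup n ℂ) → ℝ≥0∞}
    (hF : Measurable F) (θ : (unitaryLogChart n).lie → n → ℝ)
    (hθ : ∀ A : (unitaryLogChart n).lie,
      (A : Matrix n n ℂ).charpoly.roots = Finset.univ.val.map fun j => I * (θ A j : ℂ)) :
    ∫⁻ U, F U ∂(Measure.pi fun _ : B => μ) =
      (μ Set.univ / ∫⁻ A in Metric.ball 0 Real.pi, ENNReal.ofReal (∏ j, ∏ k, Real.sinc ((θ A j - θ A k) / 2)) ∂η) ^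
          Fintype.card B *
        ∫⁻ A in Set.pi Set.univ (fun _ => Metric.ball 0 Real.pi),
          F (fun b => (isChartRep_unitaryGroup (n := n)).expChart (A b)) *
            ∏ b, ENNReal.ofReal (∏ j, ∏ k, Real.sinc ((θ (A b) j - θ (A b) k) / 2)) ∂(Measure.pi fun _ : B => η) := by
  have hρ : ∀ A : (unitaryLogChart n).lie, jacDensity (lie_adStable_unitaryGroup (n := n)) A =
      ENNReal.ofReal (∏ j, ∏ k, Real.sinc ((θ A j - θ A k) / 2)) :=
    fun A => jacDensity_unitaryLogChart_eq_of_roots A (θ A) (hθ A)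
  have h := lintegral_pi_haar_unitaryGroup_eq B η μ hF
  simp only [hρ] at h
  exact h

/-- **[Balaban1985UV3] (18) FOR `U(N)`, EXPLICIT AND HYPOTHESIS-FREE** (`θ(A)` = the eigenvalues of the Hermitian
`−iA`). [cite: Balaban1985UV3, (18) p. 260] [cite: Helgason2000, Ch. I §1 Thm. 1.14 (13) p. 96] -/
theorem lintegral_pi_haar_unitaryGroup_eq_prod_sinc {F : (B → Matrix.unitaryGroup n ℂ) → ℝ≥0∞} (hF : Measurable F) :
    ∫⁻ U, F U ∂(Measure.pi fun _ : B => μ) =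
      (μ Set.univ / ∫⁻ A in Metric.ball 0 Real.pi, ENNReal.ofReal (∏ j, ∏ k,
          Real.sinc (((isHermitian_neg_I_smul (conjTranspose_eq_neg_of_mem_unitaryLogChart A)).eigenvalues j -
            (isHermitian_neg_I_smul (conjTranspose_eq_neg_of_mem_unitaryLogChart A)).eigenvalues k) / 2)) ∂η) ^
          Fintype.card B *
        ∫⁻ A in Set.pi Set.univ (fun _ => Metric.ball 0 Real.pi),
          F (fun b => (isChartRep_unitaryGroup (n := n)).expChart (A b)) *
            ∏ b, ENNReal.ofReal (∏ j, ∏ k,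
              Real.sinc (((isHermitian_neg_I_smul (conjTranspose_eq_neg_of_mem_unitaryLogChart (A b))).eigenvalues j -
                (isHermitian_neg_I_smul (conjTranspose_eq_neg_of_mem_unitaryLogChart (A b))).eigenvalues k) / 2))
          ∂(Measure.pi fun _ : B => η) :=
  lintegral_pi_haar_unitaryGroup_eq_prod_sinc_of_roots B η μ hF _
    fun A => roots_charpoly_eq_of_skewHermitian (conjTranspose_eq_neg_of_mem_unitaryLogChart A)

/-- **THE PRODUCT OF HAAR PROBABILITY MEASURES (print's normalised `Π_b dU′(b)`): `σ₀ = σ(0) = 1/∫_{‖A‖<π} Π sinc dη`,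
so the constant is `(∫_{‖A‖<π} Π_jΠ_k sinc dη)^{−|B|}`.** [cite: Balaban1985UV3, (18) p. 260]
[cite: Helgason2000, Ch. I §1 Thm. 1.14 (13) p. 96] -/
theorem lintegral_pi_haarProbability_unitaryGroup_eq_prod_sinc [IsProbabilityMeasure μ]
    {F : (B → Matrix.unitaryGroup n ℂ) → ℝ≥0∞} (hF : Measurable F) :
    ∫⁻ U, F U ∂(Measure.pi fun _ : B => μ) =
      ((∫⁻ A in Metric.ball 0 Real.pi, ENNReal.ofReal (∏ j, ∏ k,
          Real.sinc (((isHermitian_neg_I_smul (conjTranspose_eq_neg_of_mem_unitaryLogChart A)).eigenvalues j -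
            (isHermitian_neg_I_smul (conjTranspose_eq_neg_of_mem_unitaryLogChart A)).eigenvalues k) / 2)) ∂η)⁻¹) ^
          Fintype.card B *
        ∫⁻ A in Set.pi Set.univ (fun _ => Metric.ball 0 Real.pi),
          F (fun b => (isChartRep_unitaryGroup (n := n)).expChart (A b)) *
            ∏ b, ENNReal.ofReal (∏ j, ∏ k,
              Real.sinc (((isHermitian_neg_I_smul (conjTranspose_eq_neg_of_mem_unitaryLogChart (A b))).eigenvalues j -
                (isHermitian_neg_I_smul (conjTranspose_eq_neg_of_mem_unitaryLogChart (A b))).eigenvalues k) / 2))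
          ∂(Measure.pi fun _ : B => η) := by
  rw [lintegral_pi_haar_unitaryGroup_eq_prod_sinc B η μ hF, measure_univ, one_div]

end UnitaryExplicit

section OrthogonalExplicit

open HaarDensityUnitaryExplicit (isHermitian_neg_I_smul)
open HaarDensityOrthogonalExplicit (eq_unitary_mul_diagonal_mul_star)
open HaarDensityOrthogonalChart (conjTranspose_eq_neg_of_mem_lie jacDensity_specialOrthogonal_eq_of_diag)
open Complex Matrix

variable [Nonempty n] [LinearOrder n]
variable [MeasurableSpace (unitarySubgroupLogChart (specialOrthogonalSubgroup n) isClosed_specialOrthogonalSubgroup).lie]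
  [BorelSpace (unitarySubgroupLogChart (specialOrthogonalSubgroup n) isClosed_specialOrthogonalSubgroup).lie]
  (η : Measure (unitarySubgroupLogChart (specialOrthogonalSubgroup n) isClosed_specialOrthogonalSubgroup).lie)
  [η.IsAddHaarMeasure] (μ : Measure (specialOrthogonalSubgroup n)) [μ.IsHaarMeasure]

/-- **[Balaban1985UV3] (18) FOR `SO(N)` WITH THE EXPLICIT DENSITY (hypothesis-free, `θ(A)` = eigenvalues of `−iA`):
`∫_{SO(N)^B} F d(⊗μ) = σ₀^{|B|} ∫_{‖A_b‖<π ∀b} F((e^{A_b})_b) Π_b Π_{j<k} sinc((θ_j(A_b) + θ_k(A_b))/2) d(⊗η)`.**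
[cite: Balaban1985UV3, (18) p. 260] [cite: Helgason2000, Ch. I §1 Thm. 1.14 (13) p. 96] -/
theorem lintegral_pi_haar_specialOrthogonal_eq_prod_sinc {F : (B → specialOrthogonalSubgroup n) → ℝ≥0∞}
    (hF : Measurable F) :
    ∫⁻ U, F U ∂(Measure.pi fun _ : B => μ) =
      (μ Set.univ / ∫⁻ A in Metric.ball 0 Real.pi, ENNReal.ofReal (∏ p ∈ (Finset.univ : Finset (n × n)).filter
          (fun p => p.1 < p.2),
          Real.sinc (((isHermitian_neg_I_smul (conjTranspose_eq_neg_of_mem_lie A)).eigenvalues p.1 +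
            (isHermitian_neg_I_smul (conjTranspose_eq_neg_of_mem_lie A)).eigenvalues p.2) / 2)) ∂η) ^ Fintype.card B *
        ∫⁻ A in Set.pi Set.univ (fun _ => Metric.ball 0 Real.pi),
          F (fun b => (isChartRep_unitarySubgroup (specialOrthogonalSubgroup n) isClosed_specialOrthogonalSubgroup).expChart
            (A b)) *
            ∏ b, ENNReal.ofReal (∏ p ∈ (Finset.univ : Finset (n × n)).filter (fun p => p.1 < p.2),
              Real.sinc (((isHermitian_neg_I_smul (conjTranspose_eq_neg_of_mem_lie (A b))).eigenvalues p.1 +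
                (isHermitian_neg_I_smul (conjTranspose_eq_neg_of_mem_lie (A b))).eigenvalues p.2) / 2))
          ∂(Measure.pi fun _ : B => η) := by
  have hρ : ∀ A : (unitarySubgroupLogChart (specialOrthogonalSubgroup n) isClosed_specialOrthogonalSubgroup).lie,
      jacDensity (lie_adStable_unitarySubgroup (specialOrthogonalSubgroup n) isClosed_specialOrthogonalSubgroup) A =
        ENNReal.ofReal (∏ p ∈ (Finset.univ : Finset (n × n)).filter (fun p => p.1 < p.2),
          Real.sinc (((isHermitian_neg_I_smul (conjTranspose_eq_neg_of_mem_lie A)).eigenvalues p.1 +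
            (isHermitian_neg_I_smul (conjTranspose_eq_neg_of_mem_lie A)).eigenvalues p.2) / 2)) :=
    fun A => jacDensity_specialOrthogonal_eq_of_diag A _ _
      (eq_unitary_mul_diagonal_mul_star (conjTranspose_eq_neg_of_mem_lie A))
  have h := lintegral_pi_haar_specialOrthogonal_eq B η μ hF
  simp only [hρ] at h
  exact h

end OrthogonalExplicit

section SymplecticExplicit

open HaarDensityUnitaryExplicit (isHermitian_neg_I_smul)
open HaarDensityOrthogonalExplicit (eq_unitary_mul_diagonal_mul_star)
open HaarDensitySymplecticChart (conjTranspose_eq_neg_of_mem_lie jacDensity_symplectic_J_eq_of_diag)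
open Literature.LinearAlgebra.AdEigenvaluesSymplectic (pairSum)
open Complex Matrix

variable {l : Type*} [Fintype l] [DecidableEq l]
variable [MeasurableSpace (unitarySubgroupLogChart (symplecticSubgroup (Matrix.J l ℂ)) isClosed_symplecticSubgroup).lie]
  [BorelSpace (unitarySubgroupLogChart (symplecticSubgroup (Matrix.J l ℂ)) isClosed_symplecticSubgroup).lie]
  (η : Measure (unitarySubgroupLogChart (symplecticSubgroup (Matrix.J l ℂ)) isClosed_symplecticSubgroup).lie)
  [η.IsAddHaarMeasure] (μ : Measure (symplecticSubgroup (Matrix.J l ℂ))) [μ.IsHaarMeasure]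

/-- **[Balaban1985UV3] (18) FOR `Sp(n)` WITH THE EXPLICIT DENSITY (hypothesis-free):
`∫_{Sp(n)^B} F d(⊗μ) = σ₀^{|B|} ∫_{‖A_b‖<π ∀b} F((e^{A_b})_b) Π_b Π_{{j,k}} sinc((θ_j(A_b) + θ_k(A_b))/2) d(⊗η)`.**
[cite: Balaban1985UV3, (18) p. 260] [cite: Helgason2000, Ch. I §1 Thm. 1.14 (13) p. 96] -/
theorem lintegral_pi_haar_symplectic_eq_prod_sinc {F : (B → symplecticSubgroup (Matrix.J l ℂ)) → ℝ≥0∞}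
    (hF : Measurable F) :
    ∫⁻ U, F U ∂(Measure.pi fun _ : B => μ) =
      (μ Set.univ / ∫⁻ A in Metric.ball 0 Real.pi, ENNReal.ofReal (∏ p : Sym2 (l ⊕ l),
          Real.sinc (pairSum (isHermitian_neg_I_smul (conjTranspose_eq_neg_of_mem_lie A)).eigenvalues p / 2)) ∂η) ^
          Fintype.card B *
        ∫⁻ A in Set.pi Set.univ (fun _ => Metric.ball 0 Real.pi),
          F (fun b => (isChartRep_unitarySubgroup (symplecticSubgroup (Matrix.J l ℂ)) isClosed_symplecticSubgroup).expChart
            (A b)) *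
            ∏ b, ENNReal.ofReal (∏ p : Sym2 (l ⊕ l),
              Real.sinc (pairSum (isHermitian_neg_I_smul (conjTranspose_eq_neg_of_mem_lie (A b))).eigenvalues p / 2))
          ∂(Measure.pi fun _ : B => η) := by
  have hρ : ∀ A : (unitarySubgroupLogChart (symplecticSubgroup (Matrix.J l ℂ)) isClosed_symplecticSubgroup).lie,
      jacDensity (lie_adStable_unitarySubgroup (symplecticSubgroup (Matrix.J l ℂ)) isClosed_symplecticSubgroup) A =
        ENNReal.ofReal (∏ p : Sym2 (l ⊕ l),
          Real.sinc (pairSum (isHermitian_neg_I_smul (conjTranspose_eq_neg_of_mem_lie A)).eigenvalues p / 2)) :=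
    fun A => jacDensity_symplectic_J_eq_of_diag A _ _
      (eq_unitary_mul_diagonal_mul_star (conjTranspose_eq_neg_of_mem_lie A))
  have h := lintegral_pi_haar_symplectic_eq B η μ hF
  simp only [hρ] at h
  exact h

end SymplecticExplicit

end HaarExponentialChartProduct

end Literature.MathematicalPhysics.QuantumFieldTheory.Balaban1983to89

end
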